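import Summits.QuantumFields.YangMills.Theorems.BalabanUVNodesN18U3GuardsAtKernels
import Literature.MathematicalPhysics.QuantumFieldTheory.Balaban1983to89.Node00.U3OfKernelsChi

/-!
# BalabanUVNodes ∕ node N18 = NE5 — THE GUARD `SensitiveOnBoxes` AT THE KERNEL OBJECTS OF RECORD, RE-ISSUED GENERIC IN THE β-SLOT χ («Chi») WITH THE
# RE-CENTRED («Ax») INSTANCE, AND ITS PIN FORM READING-FREE: §2–§3 of `Thm/BalabanUVNodesN18U3GuardsAtKernels` (dag-n18-w2, p592505) over `Node00/U3OfKernelsChi`'s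
# `objectsOfRecord₁₃Chi θ χ ℓ` ∕ `objectsOfRecord₁₃Ax θ ℓ` (dag-n16-e g30, p802930) — op 5c K3ᴬ supply row R14

Cell `pub-ymgap`, seat `pub-ymgap-dag-n15-a` g38 (dag-lead WORDS 591∕592∕595 HANDS-4a row R14; plan g99 `OP5C-SUPPLY-CENSUS-K3v8.md` §2 row 14 + σ5; LOCATED by
dag-n16-e g30, pub-ymgap INBOX l.21817, confirmed l.21830).  `--supports stmt-QuantumFields-27247` (K3ᴬ `SpineGivenEndpointR13SepCoPHVAx`) AS A HELPER — count-neutral;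
PROOF lane (0 `def`).  NEW basename beside the untouched parent (body-freeze; the [Ax-3c]∕[Ax-3d] pattern: centre-generic edition + Ax instance).

THE POINT.  The parent's §2∕§3 read W1-19's `objectsOfRecord₁₃ θ ℓ`, built at the CHOICE-centred (2.9) cut-off `chiβOfRecord₁₃ θ`, and conclude about the CHOICE β
`betaOfRecord₁₃ θ`; the K3ᴬ skeleton (v8) displays `betaOfRecord₁₃Ax` and — after plan g99's σ5 — pins node U3's objects to `objectsOfRecord₁₃Ax` (`Node00/U3OfKernelsChi`,
dag-n16-e g30).  This file is the parent's §2 with `objectsOfRecord₁₃ ↦ objectsOfRecord₁₃Chi θ χ` ∕ `betaOfRecord₁₃ ↦ betaOfRecord₁₃Chi θ χ` (θ-level, any χ), the Ax instances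
(`χ := chiβOfRecord₁₃Ax θ`; `betaOfRecord₁₃Chi θ (chiβOfRecord₁₃Ax θ)` IS `betaOfRecord₁₃Ax θ`, both `abbrev`s over `betaOfRecord₈Tχ`), and the parent's §3 pin form made
READING-FREE: for ANY node-U3 object `X : U3Objects₁₁` with `hX : X = objectsOfRecord₁₃Chi θ χ ℓ` (resp. `= objectsOfRecord₁₃Ax θ ℓ`) — so the K3ᴬ v8 rows
`sensitive_rrOfRecord_of_pinned` ∕ `boxwiseConstant_of_pinned_blind` follow by ONE TERM at `hX := hpin F θ hP g₀ os` whatever the reading TYPE of the skeleton is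
(`(rrOfRecord 𝔯 ksel F θ hP g₀ os).u3` IS `u3OfRecord₁₃ θ.toStage13Params (𝔯.lit F θ hP g₀ os).u3 (ksel …)`); the editions typed over the centre-map-generic reading
`RateReading₁₃CoPHCmap N Χ` (T1 `Thm/BalabanUVNodesRateCarriersOfRecord13CoPHCmap`, dag-n15-c) are one-liners over §2P and follow T1 in a separate module.  Every proof is the
parent's, one token changed; §1 of the parent (generic term family `ℰ`) is χ-free and is USED, not re-declared.

WHAT IS PROVED.
* §2χ at `objectsOfRecord₁₃Chi F N θ χ ℓ` (β `betaOfRecord₁₃Chi F N θ χ`): `boxwiseConstant_betaOfRecord₁₃Chi_of_blindOnBoxes`, ★★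
  `sensitiveOnBoxes_objectsOfRecord₁₃Chi_of_not_boxwiseConstant`, `sensitiveOnBoxes_u3OfRecord₁₃_objectsOfRecord₁₃Chi`, `u3OfRecord₁₃_objectsOfRecord₁₃Chi_eq` (`rfl`);
  §2A the same at `objectsOfRecord₁₃Ax` ∕ `betaOfRecord₁₃Ax` (one-line specialisations).
* §2P PIN FORM, reading-free (`X : U3Objects₁₁`, `hX : X = objectsOfRecord₁₃Chi F N θ χ ℓ`): ★★ `sensitiveOnBoxes_u3OfRecord₁₃_of_eq_objectsOfRecord₁₃Chi` (+ `'` with the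
  radius displayed `θ.γ`) — every run-length bundle `u3OfRecord₁₃ θ X k` passes the guard at every tuple whose `betaOfRecord₁₃Chi θ χ` is not boxwise constant — and
  `boxwiseConstant_betaOfRecord₁₃Chi_of_blind_of_eq_objectsOfRecord₁₃Chi`; the Ax instances ★★ `sensitiveOnBoxes_u3OfRecord₁₃_of_eq_objectsOfRecord₁₃Ax` ∕
  `boxwiseConstant_betaOfRecord₁₃Ax_of_blind_of_eq_objectsOfRecord₁₃Ax` (pin at `objectsOfRecord₁₃Ax`, β `betaOfRecord₁₃Ax` — the K3ᴬ v8 probe's l.591–600 conclusions).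

HONEST FRAMING.  Count-neutral helper; bookkeeping over W1-19's objects re-issued in χ (values residual: `polLimit` total `limUnder`, infinite-volume kernels); nothing of
Bałaban's asserted; NE5 ∕ NE9 ∕ (D4) NOT PRINTED for d = 4 ∕ NOT proved; β-non-degeneracy NOT proved (displayed hypothesis, NODE O's); N18 NOT discharged; K3ᴬ OPEN, not claimed;
counts UNMOVED (typed 28∕28 · discharged 8∕27 (A 8∕28)).  One finite four-torus programme at fixed `ε`; R4 closes the conditional finite-𝕋⁴ rung `BalabanLadder.UV` only — NOT ℝ⁴,
NOT infinite volume, NOT OS, NOT a mass gap, NOT Clay.  No `def`, no `sorry`.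
-/

set_option autoImplicit false

noncomputable section

namespace YMDAG.N18.U3GuardsAtKernels

open Literature.MathematicalPhysics.QuantumFieldTheory.Balaban1983to89
open Literature.MathematicalPhysics.QuantumFieldTheory.Balaban1983to89.T4Continuum
open Literature.MathematicalPhysics.QuantumFieldTheory.Balaban1983to89.T4OutputRate (Carriers Functional)
open Literature.MathematicalPhysics.QuantumFieldTheory.Balaban1983to89.Node00 (Stage13Params Stage13HParams ChiSlot betaOfRecord₁₃Chi betaOfRecord₁₃Ax chiβOfRecord₁₃Ax
  U3Objects₁₁ U3Letters₁₁)
open Literature.MathematicalPhysics.QuantumFieldTheory.Balaban1983to89.Node00.U3OfKernels (objectsOfRecord₁₃Chi objectsOfRecord₁₃Ax representsA_objectsOfRecord₁₃_chi)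
open YMDAG.UVSplit
open YMDAG.N18.U3Guards

/-! ## §2χ At the Stage-13 record, β-slot χ: the guard at `U3OfKernels.objectsOfRecord₁₃Chi` -/

section RecordChi

variable {F : T4Family} {N : ℕ} [NeZero N] (θ : Stage13Params F N) (χ : ChiSlot F N) (ℓ : U3Letters₁₁) (k : ℕ)

/-- **KERNELS OF RECORD (β-SLOT χ) BLIND TO THE BOX HISTORIES FORCE `betaOfRecord₁₃Chi θ χ` BOXWISE CONSTANT** (`U3OfKernelsChi.representsA_objectsOfRecord₁₃_chi`, no
hypothesis, + `U3Guards.boxwiseConstant_of_representsA_blind`). [folklore] -/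
theorem boxwiseConstant_betaOfRecord₁₃Chi_of_blindOnBoxes (h : BlindOnBoxes ((objectsOfRecord₁₃Chi F N θ χ ℓ).EA k) θ.γ) :
    BoxwiseConstant θ.γ (betaOfRecord₁₃Chi F N θ χ) :=
  boxwiseConstant_of_representsA_blind (representsA_objectsOfRecord₁₃_chi F N θ χ ℓ k) h

/-- **★★ THE χ-GENERIC OBJECTS OF RECORD PASS THE node-U3 GUARD AT EVERY TUPLE WHOSE `betaOfRecord₁₃Chi θ χ` IS NOT BOXWISE CONSTANT** — β-non-degeneracy is the displayed
hypothesis (NODE O's, not decidable here). [folklore] -/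
theorem sensitiveOnBoxes_objectsOfRecord₁₃Chi_of_not_boxwiseConstant (hβ : ¬ BoxwiseConstant θ.γ (betaOfRecord₁₃Chi F N θ χ)) :
    SensitiveOnBoxes ((objectsOfRecord₁₃Chi F N θ χ ℓ).EA k) θ.γ :=
  sensitiveOnBoxes_of_representsA (representsA_objectsOfRecord₁₃_chi F N θ χ ℓ k) hβ

/-- The same at node U3's BUNDLE OF RECORD of the χ-generic kernel objects (any run-length index; `U3Guards.sensitiveOnBoxes_u3OfRecord₁₃_iff`). [folklore] -/
theorem sensitiveOnBoxes_u3OfRecord₁₃_objectsOfRecord₁₃Chi (hβ : ¬ BoxwiseConstant θ.γ (betaOfRecord₁₃Chi F N θ χ)) :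
    SensitiveOnBoxes (u3OfRecord₁₃ θ (objectsOfRecord₁₃Chi F N θ χ ℓ) k).EA (u3OfRecord₁₃ θ (objectsOfRecord₁₃Chi F N θ χ ℓ) k).γ :=
  (sensitiveOnBoxes_u3OfRecord₁₃_iff θ _ k).mpr (sensitiveOnBoxes_objectsOfRecord₁₃Chi_of_not_boxwiseConstant θ χ ℓ k hβ)

/-- The bundle of record of the χ-generic kernel objects does not depend on the run-length index (`rfl`; the objects are a fixed-carrier reading). [folklore] -/
theorem u3OfRecord₁₃_objectsOfRecord₁₃Chi_eq (k₁ k₂ : ℕ) :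
    u3OfRecord₁₃ θ (objectsOfRecord₁₃Chi F N θ χ ℓ) k₁ = u3OfRecord₁₃ θ (objectsOfRecord₁₃Chi F N θ χ ℓ) k₂ := rfl

end RecordChi

/-! ## §2A At the RE-CENTRED record: the guard at `U3OfKernels.objectsOfRecord₁₃Ax`, β `betaOfRecord₁₃Ax` -/

section RecordAx

variable {F : T4Family} {N : ℕ} [NeZero N] (θ : Stage13Params F N) (ℓ : U3Letters₁₁) (k : ℕ)

/-- **RE-CENTRED KERNELS OF RECORD BLIND TO THE BOX HISTORIES FORCE `betaOfRecord₁₃Ax` BOXWISE CONSTANT** (§2χ at `χ := chiβOfRecord₁₃Ax θ`). [folklore] -/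
theorem boxwiseConstant_betaOfRecord₁₃Ax_of_blindOnBoxes (h : BlindOnBoxes ((objectsOfRecord₁₃Ax F N θ ℓ).EA k) θ.γ) :
    BoxwiseConstant θ.γ (betaOfRecord₁₃Ax F N θ) :=
  boxwiseConstant_betaOfRecord₁₃Chi_of_blindOnBoxes θ (chiβOfRecord₁₃Ax F N θ) ℓ k h

/-- **★★ THE RE-CENTRED OBJECTS OF RECORD PASS THE node-U3 GUARD AT EVERY TUPLE WHOSE `betaOfRecord₁₃Ax` IS NOT BOXWISE CONSTANT** (§2χ at `χ := chiβOfRecord₁₃Ax θ`). [folklore] -/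
theorem sensitiveOnBoxes_objectsOfRecord₁₃Ax_of_not_boxwiseConstant (hβ : ¬ BoxwiseConstant θ.γ (betaOfRecord₁₃Ax F N θ)) :
    SensitiveOnBoxes ((objectsOfRecord₁₃Ax F N θ ℓ).EA k) θ.γ :=
  sensitiveOnBoxes_objectsOfRecord₁₃Chi_of_not_boxwiseConstant θ (chiβOfRecord₁₃Ax F N θ) ℓ k hβ

/-- The same at node U3's bundle of record of the re-centred kernel objects (any run-length index). [folklore] -/
theorem sensitiveOnBoxes_u3OfRecord₁₃_objectsOfRecord₁₃Ax (hβ : ¬ BoxwiseConstant θ.γ (betaOfRecord₁₃Ax F N θ)) :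
    SensitiveOnBoxes (u3OfRecord₁₃ θ (objectsOfRecord₁₃Ax F N θ ℓ) k).EA (u3OfRecord₁₃ θ (objectsOfRecord₁₃Ax F N θ ℓ) k).γ :=
  sensitiveOnBoxes_u3OfRecord₁₃_objectsOfRecord₁₃Chi θ (chiβOfRecord₁₃Ax F N θ) ℓ k hβ

end RecordAx

/-! ## §2P Pin form, READING-FREE: any node-U3 object family EQUAL to the χ-generic ∕ re-centred kernel objects of record (the K3ᴬ v8 `U3PinnedKernels` clause
`(𝔯.lit F θ hP g₀ os).u3 = objectsOfRecord₁₃Ax F 2 θ.toStage13Params (ℓ F θ)` instantiates `hX`; the bundle `(rrOfRecord 𝔯 ksel F θ hP g₀ os).u3` IS `u3OfRecord₁₃ θ.toStage13Params _ (ksel …)`) -/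

section PinnedFree

variable {F : T4Family} {N : ℕ} [NeZero N] (θ : Stage13Params F N) (χ : ChiSlot F N) (ℓ : U3Letters₁₁) {X : U3Objects₁₁}

/-- **★★ PIN FORM (χ-generic, reading-free): A node-U3 OBJECT PINNED TO THE χ-GENERIC KERNEL OBJECTS OF RECORD GIVES, AT EVERY RUN-LENGTH INDEX, A BUNDLE THAT PASSES THE
GUARD AT EVERY TUPLE WHOSE `betaOfRecord₁₃Chi θ χ` IS NOT BOXWISE CONSTANT** — the K3ᴬ `KeyedSensitive` conclusion `SensitiveOnBoxes (rrOfRecord 𝔯 ksel F θ hP g₀ os).u3.EA θ.γ` under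
the pin, for ANY reading type (the parent's §3 without its `RateReading₁₃CoPH` binder). [folklore] -/
theorem sensitiveOnBoxes_u3OfRecord₁₃_of_eq_objectsOfRecord₁₃Chi (hX : X = objectsOfRecord₁₃Chi F N θ χ ℓ) (hβ : ¬ BoxwiseConstant θ.γ (betaOfRecord₁₃Chi F N θ χ)) (k : ℕ) :
    SensitiveOnBoxes (u3OfRecord₁₃ θ X k).EA (u3OfRecord₁₃ θ X k).γ := by
  subst hX
  exact sensitiveOnBoxes_u3OfRecord₁₃_objectsOfRecord₁₃Chi θ χ ℓ k hβ

/-- The same with the window radius displayed as `θ.γ` (`(u3OfRecord₁₃ θ X k).γ` IS `θ.γ`, `rfl`). [folklore] -/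
theorem sensitiveOnBoxes_u3OfRecord₁₃_of_eq_objectsOfRecord₁₃Chi' (hX : X = objectsOfRecord₁₃Chi F N θ χ ℓ) (hβ : ¬ BoxwiseConstant θ.γ (betaOfRecord₁₃Chi F N θ χ)) (k : ℕ) :
    SensitiveOnBoxes (u3OfRecord₁₃ θ X k).EA θ.γ := by
  subst hX
  exact sensitiveOnBoxes_objectsOfRecord₁₃Chi_of_not_boxwiseConstant θ χ ℓ k hβ

/-- **… and, conversely (χ-generic, reading-free): a pinned object with SOME run-length bundle BLIND over the record's boxes forces `betaOfRecord₁₃Chi θ χ` boxwise constant.** [folklore] -/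
theorem boxwiseConstant_betaOfRecord₁₃Chi_of_blind_of_eq_objectsOfRecord₁₃Chi (hX : X = objectsOfRecord₁₃Chi F N θ χ ℓ) (k : ℕ)
    (h : BlindOnBoxes (u3OfRecord₁₃ θ X k).EA θ.γ) : BoxwiseConstant θ.γ (betaOfRecord₁₃Chi F N θ χ) := by
  subst hX
  exact boxwiseConstant_betaOfRecord₁₃Chi_of_blindOnBoxes θ χ ℓ k h

/-- **★★ PIN FORM AT THE RE-CENTRED RECORD (reading-free): an object pinned to `objectsOfRecord₁₃Ax θ ℓ` gives bundles that pass the guard at every tuple whose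
`betaOfRecord₁₃Ax θ` is not boxwise constant** — the K3ᴬ v8 row `sensitive_rrOfRecord_of_pinned` under `U3PinnedKernels` (σ5: pin at the Ax objects), by ONE term. [folklore] -/
theorem sensitiveOnBoxes_u3OfRecord₁₃_of_eq_objectsOfRecord₁₃Ax (hX : X = objectsOfRecord₁₃Ax F N θ ℓ) (hβ : ¬ BoxwiseConstant θ.γ (betaOfRecord₁₃Ax F N θ)) (k : ℕ) :
    SensitiveOnBoxes (u3OfRecord₁₃ θ X k).EA θ.γ :=
  sensitiveOnBoxes_u3OfRecord₁₃_of_eq_objectsOfRecord₁₃Chi' θ (chiβOfRecord₁₃Ax F N θ) ℓ hX hβ k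

/-- **… and the re-centred converse: a pinned object with a BLIND run-length bundle forces `betaOfRecord₁₃Ax θ` boxwise constant** — the K3ᴬ v8 row
`boxwiseConstant_of_pinned_blind`, by ONE term. [folklore] -/
theorem boxwiseConstant_betaOfRecord₁₃Ax_of_blind_of_eq_objectsOfRecord₁₃Ax (hX : X = objectsOfRecord₁₃Ax F N θ ℓ) (k : ℕ) (h : BlindOnBoxes (u3OfRecord₁₃ θ X k).EA θ.γ) :
    BoxwiseConstant θ.γ (betaOfRecord₁₃Ax F N θ) :=
  boxwiseConstant_betaOfRecord₁₃Chi_of_blind_of_eq_objectsOfRecord₁₃Chi θ (chiβOfRecord₁₃Ax F N θ) ℓ hX k h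

end PinnedFree

end YMDAG.N18.U3GuardsAtKernels

end
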